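import Mathlib
import HarnessLib

/-!
# Analytic and algebraic tools for `RetrievalSynthesisR` (stmt-CriticalPhenomena-14011, route `SAWPhaseRetrieval`)

Folklore lemmas used by the layer-1 glue `PhaseLawR → RetrievalStabilityR → BoundaryAnchoring →
HexObservableLimitR`:

* `differentiableOn_of_exp_eq` — a continuous logarithm `L` of a holomorphic non-vanishing function
  (`exp ∘ L = f` on an open set) is holomorphic;
* `continuous_mul_exp_of_tsupport_subset` — `ψ · e^{(5/8)(L - L_b)}` is continuous when `ψ`
  is continuous with `tsupport ψ ⊆ U`, `U` open, and `L` is continuous on `U`;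
* `exists_bump` — continuous compactly supported `χ : ℂ → ℝ`, `0 ≤ χ ≤ 1`, `χ = 1` on a compact `K`,
  `tsupport χ ⊆ U` (Urysohn);
* unit-vector algebra: `unit_mul`, `norm_rotate_phase` (transfer of the phase law from `F/F(b)` to
  the rotated observable `F · w`), `norm_sub_smul_le` (modulus/argument splitting of
  `‖x - c u y‖`), `exp_div_norm`, `norm_exp_mul_eq`;
* real bookkeeping: `kappa_bounds`, `abs_sub_le_of_kappa_bounds` (pinning the free scalar of
  retrieval on the anchoring ball), `pointwise_bound` (termwise modulus/argument estimate).
-/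

noncomputable section

namespace Summit.CriticalPhenomena.SAWScalingLimit.Theorems.RetrievalSynthesisR

open scoped BigOperators Topology ComplexConjugate
open Filter Set Metric MeasureTheory Complex

/-! ### A continuous logarithm of a holomorphic function is holomorphic -/

/-- **A continuous branch of `log f` is holomorphic.** If `f` is holomorphic on the open set `U`,
`L` is continuous on `U` and `exp (L z) = f z` on `U`, then `L` is holomorphic on `U` (locally
`L = L z₀ + log (f / f z₀)` with the principal branch). [folklore] -/
theorem differentiableOn_of_exp_eq {U : Set ℂ} (hU : IsOpen U) {L f : ℂ → ℂ}
    (hf : DifferentiableOn ℂ f U) (hL : ContinuousOn L U)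
    (hexp : ∀ z ∈ U, Complex.exp (L z) = f z) : DifferentiableOn ℂ L U := by
  intro z₀ hz₀
  have hU0 : U ∈ 𝓝 z₀ := hU.mem_nhds hz₀
  have hf0 : f z₀ ≠ 0 := by rw [← hexp z₀ hz₀]; exact Complex.exp_ne_zero _
  -- the local representation
  set h : ℂ → ℂ := fun z => L z₀ + Complex.log (f z / f z₀) with hh
  have hLc : ContinuousAt L z₀ := hL.continuousAt hU0
  have hev : L =ᶠ[𝓝 z₀] h := by
    have e1 : ∀ᶠ z in 𝓝 z₀, dist (L z) (L z₀) < Real.pi :=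
      (Metric.tendsto_nhds.1 hLc) Real.pi Real.pi_pos
    filter_upwards [hU0, e1] with z hz hd
    have hquot : Complex.exp (L z - L z₀) = f z / f z₀ := by
      rw [Complex.exp_sub, hexp z hz, hexp z₀ hz₀]
    have him : |(L z - L z₀).im| < Real.pi := by
      rw [dist_eq_norm] at hd
      exact (Complex.abs_im_le_norm _).trans_lt hd
    have hlog : Complex.log (f z / f z₀) = L z - L z₀ := by
      rw [← hquot, Complex.log_exp (by linarith [(abs_lt.1 him).1]) (abs_lt.1 him).2.le]
    simp only [hh, hlog]; ring
  have hfd : DifferentiableAt ℂ f z₀ := hf.differentiableAt hU0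
  have hhd : DifferentiableAt ℂ h z₀ := by
    refine (differentiableAt_const _).add ?_
    refine (Complex.differentiableAt_log ?_).comp z₀ (hfd.div_const _)
    rw [div_self hf0]
    exact Complex.one_mem_slitPlane
  exact (hhd.congr_of_eventuallyEq hev).differentiableWithinAt

/-! ### Test functions -/

/-- The limit density `ψ · e^{(5/8)(L - L_b)}` is continuous on `ℂ` when `ψ` is continuous with
`tsupport ψ` inside the open set `U` and `L` is continuous on `U` (outside `U` the product vanishes
near every point; the general `ψ · g` form is
`BoundaryClosure.Negative.continuous_mul_of_tsupport_subset`). [folklore] -/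
theorem continuous_mul_exp_of_tsupport_subset {U : Set ℂ} (hU : IsOpen U) {ψ L : ℂ → ℂ}
    (hψ : Continuous ψ) (hψU : tsupport ψ ⊆ U) (hL : ContinuousOn L U) (Lb : ℂ) :
    Continuous fun z => ψ z * Complex.exp ((5 / 8 : ℂ) * (L z - Lb)) := by
  have hE : ContinuousOn (fun z => Complex.exp ((5 / 8 : ℂ) * (L z - Lb))) U :=
    Complex.continuous_exp.comp_continuousOn (continuousOn_const.mul (hL.sub continuousOn_const))
  rw [continuous_iff_continuousAt]
  intro z
  by_cases hz : z ∈ U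
  · exact hψ.continuousAt.mul (hE.continuousAt (hU.mem_nhds hz))
  · have hz' : z ∉ tsupport ψ := fun h => hz (hψU h)
    have hev : (fun z => ψ z * Complex.exp ((5 / 8 : ℂ) * (L z - Lb))) =ᶠ[𝓝 z] fun _ => 0 := by
      filter_upwards [notMem_tsupport_iff_eventuallyEq.1 hz'] with y hy
      simp [hy]
    exact continuousAt_const.congr_of_eventuallyEq hev

/-- `ψ · E` has compact support inside `U` if `ψ` does. [folklore] -/
theorem tsupport_mul_subset {U : Set ℂ} {ψ E : ℂ → ℂ} (hψU : tsupport ψ ⊆ U) :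
    tsupport (fun z => ψ z * E z) ⊆ U :=
  (tsupport_mul_subset_left (f := ψ) (g := E)).trans hψU

/-- **Bump functions.** For a compact `K` inside an open `U ⊆ ℂ` there is a continuous compactly
supported `χ : ℂ → ℝ` with `0 ≤ χ ≤ 1`, `χ = 1` on `K` and `tsupport χ ⊆ U`. [folklore] -/
theorem exists_bump {U K : Set ℂ} (hU : IsOpen U) (hK : IsCompact K) (hKU : K ⊆ U) :
    ∃ χ : ℂ → ℝ, Continuous χ ∧ HasCompactSupport χ ∧ tsupport χ ⊆ U ∧
      (∀ z, 0 ≤ χ z) ∧ (∀ z, χ z ≤ 1) ∧ ∀ z ∈ K, χ z = 1 := by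
  obtain ⟨V, hV, hKV, hVU, -⟩ := exists_open_between_and_isCompact_closure hK hU hKU
  obtain ⟨f, hf1, hf0, hfs, hf01⟩ :=
    exists_continuous_one_zero_of_isCompact hK hV.isClosed_compl
      (disjoint_compl_right_iff_subset.2 hKV)
  refine ⟨f, f.continuous, hfs, ?_, fun z => (hf01 z).1, fun z => (hf01 z).2, fun z hz => hf1 hz⟩
  refine (closure_mono ?_).trans hVU
  intro z hz
  by_contra hzV
  exact hz (hf0 hzV)

/-- A bump function equal to `1` at a point has positive integral. [folklore] -/
theorem integral_bump_pos {χ : ℂ → ℝ} (hχ : Continuous χ) (hχs : HasCompactSupport χ)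
    (h0 : ∀ z, 0 ≤ χ z) {z₀ : ℂ} (h1 : χ z₀ = 1) : 0 < ∫ z, χ z := by
  refine integral_pos_of_integrable_nonneg_nonzero hχ (hχ.integrable_of_hasCompactSupport hχs)
    (fun z => h0 z) (x := z₀) ?_
  rw [h1]; exact one_ne_zero

/-! ### Unit vectors -/

/-- `x / ‖x‖ · ‖x‖ = x` (also for `x = 0`). [folklore] -/
theorem div_norm_mul_norm (x : ℂ) : x / ((‖x‖ : ℝ) : ℂ) * ((‖x‖ : ℝ) : ℂ) = x := by
  rcases eq_or_ne x 0 with rfl | hx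
  · simp
  · rw [div_mul_cancel₀]
    exact_mod_cast (norm_ne_zero_iff.2 hx)

/-- The unit vector of a non-zero complex number has norm `1`. [folklore] -/
theorem norm_div_norm {x : ℂ} (hx : x ≠ 0) : ‖x / ((‖x‖ : ℝ) : ℂ)‖ = 1 := by
  rw [norm_div, Complex.norm_real, Real.norm_eq_abs, abs_of_pos (norm_pos_iff.2 hx),
    div_self (norm_ne_zero_iff.2 hx)]

/-- Unit vectors are multiplicative. [folklore] -/
theorem unit_mul (x y : ℂ) :
    x * y / ((‖x * y‖ : ℝ) : ℂ) = x / ((‖x‖ : ℝ) : ℂ) * (y / ((‖y‖ : ℝ) : ℂ)) := by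
  rw [norm_mul, Complex.ofReal_mul, div_mul_div_comm]

/-- Unit vectors of quotients. [folklore] -/
theorem unit_div (x y : ℂ) :
    x / y / ((‖x / y‖ : ℝ) : ℂ) = x / ((‖x‖ : ℝ) : ℂ) / (y / ((‖y‖ : ℝ) : ℂ)) := by
  rw [norm_div, Complex.ofReal_div, div_div_div_comm]

/-- The unit vector of a unimodular number is itself. [folklore] -/
theorem unit_of_norm_eq_one {w : ℂ} (hw : ‖w‖ = 1) : w / ((‖w‖ : ℝ) : ℂ) = w := by
  rw [hw]; simp

/-- For a non-zero `y`, the inverse of its unit vector is the conjugate. [folklore] -/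
theorem inv_unit_eq_conj {y : ℂ} (hy : y ≠ 0) :
    (y / ((‖y‖ : ℝ) : ℂ))⁻¹ = conj (y / ((‖y‖ : ℝ) : ℂ)) := by
  have h1 : ‖y / ((‖y‖ : ℝ) : ℂ)‖ = 1 := norm_div_norm hy
  rw [Complex.inv_def, Complex.normSq_eq_norm_sq, h1]
  simp

/-- **Transfer of the phase law to the rotated observable.** With
`w = conj (y/‖y‖) · conj u · exp(i (5/8) θ_b)`, `‖u‖ = 1`, `y ≠ 0`:
`‖(x w)/‖x w‖ - exp(i (5/8) θ)‖ = ‖(x/y)/‖x/y‖ - u exp(i (5/8) (θ - θ_b))‖`. [folklore] -/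
theorem norm_rotate_phase (x y u : ℂ) (θ θb : ℝ) (hy : y ≠ 0) (hu : ‖u‖ = 1) :
    ‖x * (conj (y / ((‖y‖ : ℝ) : ℂ)) * conj u * Complex.exp (Complex.I * (5 / 8 : ℂ) * (θb : ℂ))) /
        ((‖x * (conj (y / ((‖y‖ : ℝ) : ℂ)) * conj u *
          Complex.exp (Complex.I * (5 / 8 : ℂ) * (θb : ℂ)))‖ : ℝ) : ℂ) -
        Complex.exp (Complex.I * (5 / 8 : ℂ) * (θ : ℂ))‖ =
      ‖x / y / ((‖x / y‖ : ℝ) : ℂ) - u * Complex.exp (Complex.I * (5 / 8 : ℂ) * ((θ - θb : ℝ) : ℂ))‖ := by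
  set v : ℂ := y / ((‖y‖ : ℝ) : ℂ) with hv
  set eb : ℂ := Complex.exp (Complex.I * (5 / 8 : ℂ) * (θb : ℂ)) with heb
  set w : ℂ := conj v * conj u * eb with hw
  have hvn : ‖v‖ = 1 := norm_div_norm hy
  have hebn : ‖eb‖ = 1 := by
    rw [heb, Complex.norm_exp]
    simp
  have hcu : ‖conj u‖ = 1 := by rw [Complex.norm_conj, hu]
  have hcv : ‖conj v‖ = 1 := by rw [Complex.norm_conj, hvn]
  have hwn : ‖w‖ = 1 := by rw [hw, norm_mul, norm_mul, hcv, hcu, hebn]; norm_num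
  have hm : ‖conj u * eb‖ = 1 := by rw [norm_mul, hcu, hebn, mul_one]
  -- unit vector of `x w`
  have h1 : x * w / ((‖x * w‖ : ℝ) : ℂ) = x / ((‖x‖ : ℝ) : ℂ) * w := by
    rw [unit_mul, unit_of_norm_eq_one hwn]
  -- unit vector of `x / y`
  have h2 : x / y / ((‖x / y‖ : ℝ) : ℂ) = x / ((‖x‖ : ℝ) : ℂ) * conj v := by
    rw [unit_div, div_eq_mul_inv, ← hv, inv_unit_eq_conj hy]
  rw [h1, h2]
  -- multiply the second expression by the unimodular `conj u * eb`
  have key : (x / ((‖x‖ : ℝ) : ℂ) * conj v -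
      u * Complex.exp (Complex.I * (5 / 8 : ℂ) * ((θ - θb : ℝ) : ℂ))) * (conj u * eb) =
      x / ((‖x‖ : ℝ) : ℂ) * w - Complex.exp (Complex.I * (5 / 8 : ℂ) * (θ : ℂ)) := by
    have huu : u * conj u = 1 := by
      rw [Complex.mul_conj, Complex.normSq_eq_norm_sq, hu]; simp
    have hexp : Complex.exp (Complex.I * (5 / 8 : ℂ) * ((θ - θb : ℝ) : ℂ)) * eb =
        Complex.exp (Complex.I * (5 / 8 : ℂ) * (θ : ℂ)) := by
      rw [heb, ← Complex.exp_add]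
      congr 1
      push_cast; ring
    calc _ = x / ((‖x‖ : ℝ) : ℂ) * (conj v * conj u * eb) -
          (u * conj u) * (Complex.exp (Complex.I * (5 / 8 : ℂ) * ((θ - θb : ℝ) : ℂ)) * eb) := by ring
      _ = _ := by rw [huu, hexp, one_mul, hw]
  rw [← key, norm_mul, hm, mul_one]

/-- **Modulus/argument splitting.** For `‖u‖ = 1`, `y ≠ 0`, `0 ≤ c`:
`‖x - c u y‖ ≤ ‖x‖ ‖x/‖x‖ - u y/‖y‖‖ + |‖x‖ - c ‖y‖|`. [folklore] -/
theorem norm_sub_smul_le (x y u : ℂ) (c : ℝ) (hu : ‖u‖ = 1) (hy : y ≠ 0) :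
    ‖x - (c : ℂ) * u * y‖ ≤
      ‖x‖ * ‖x / ((‖x‖ : ℝ) : ℂ) - u * (y / ((‖y‖ : ℝ) : ℂ))‖ + |‖x‖ - c * ‖y‖| := by
  set U := x / ((‖x‖ : ℝ) : ℂ) with hU
  set P := y / ((‖y‖ : ℝ) : ℂ) with hP
  have hxU : ((‖x‖ : ℝ) : ℂ) * U = x := by rw [hU, mul_comm, div_norm_mul_norm]
  have hyP : ((‖y‖ : ℝ) : ℂ) * P = y := by rw [hP, mul_comm, div_norm_mul_norm]
  have hPn : ‖P‖ = 1 := norm_div_norm hy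
  have hid : x - (c : ℂ) * u * y =
      ((‖x‖ : ℝ) : ℂ) * (U - u * P) + ((‖x‖ - c * ‖y‖ : ℝ) : ℂ) * (u * P) := by
    conv_lhs => rw [← hxU, ← hyP]
    push_cast; ring
  rw [hid]
  calc _ ≤ ‖((‖x‖ : ℝ) : ℂ) * (U - u * P)‖ + ‖((‖x‖ - c * ‖y‖ : ℝ) : ℂ) * (u * P)‖ := norm_add_le _ _
    _ = ‖x‖ * ‖U - u * P‖ + |‖x‖ - c * ‖y‖| := by
        rw [norm_mul, norm_mul, Complex.norm_real, Complex.norm_real, Real.norm_eq_abs,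
          Real.norm_eq_abs, abs_norm, norm_mul, hu, hPn, mul_one, mul_one]

/-- The unit vector of `exp w` is `exp (i · Im w)`. [folklore] -/
theorem exp_div_norm (w : ℂ) :
    Complex.exp w / ((‖Complex.exp w‖ : ℝ) : ℂ) = Complex.exp (Complex.I * (w.im : ℂ)) := by
  rw [Complex.norm_exp]
  have h : Complex.exp w = ((Real.exp w.re : ℝ) : ℂ) * Complex.exp (Complex.I * (w.im : ℂ)) := by
    rw [Complex.ofReal_exp, ← Complex.exp_add]
    congr 1
    conv_lhs => rw [← Complex.re_add_im w]
    ring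
  rw [h, mul_div_cancel_left₀]
  exact_mod_cast (Real.exp_pos w.re).ne'

/-- `Im ((5/8) (a - b)) = (5/8) (Im a - Im b)` packaged as the phase identity used with `PhaseLawR`:
`exp(i · Im((5/8)(a - b))) = exp(i (5/8) Im(a - b))`. [folklore] -/
theorem exp_I_im_mul_sub (a b : ℂ) :
    Complex.exp (Complex.I * ((((5 / 8 : ℂ) * (a - b)).im : ℝ) : ℂ)) =
      Complex.exp (Complex.I * (5 / 8 : ℂ) * (((a - b).im : ℝ) : ℂ)) := by
  congr 1
  have : ((5 / 8 : ℂ) * (a - b)).im = 5 / 8 * (a - b).im := by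
    rw [show (5 / 8 : ℂ) = ((5 / 8 : ℝ) : ℂ) by norm_num, Complex.im_ofReal_mul]
  rw [this]; push_cast; ring

/-- `‖exp((5/8) a)‖ = ‖exp((5/8)(a - b))‖ · exp((5/8) Re b)`. [folklore] -/
theorem norm_exp_mul_eq (a b : ℂ) :
    ‖Complex.exp ((5 / 8 : ℂ) * a)‖ =
      ‖Complex.exp ((5 / 8 : ℂ) * (a - b))‖ * Real.exp (5 / 8 * b.re) := by
  rw [Complex.norm_exp, Complex.norm_exp, ← Real.exp_add]
  congr 1
  have h1 : ((5 / 8 : ℂ) * a).re = 5 / 8 * a.re := by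
    rw [show (5 / 8 : ℂ) = ((5 / 8 : ℝ) : ℂ) by norm_num, Complex.re_ofReal_mul]
  have h2 : ((5 / 8 : ℂ) * (a - b)).re = 5 / 8 * (a.re - b.re) := by
    rw [show (5 / 8 : ℂ) = ((5 / 8 : ℝ) : ℂ) by norm_num, Complex.re_ofReal_mul, Complex.sub_re]
  rw [h1, h2]; ring

/-! ### Pinning the free scalar: real bookkeeping -/

/-- **The two inequalities for `X = κ Λ_b` from the anchoring ball.** Over a finite set `T` of
mid-edges with `α₀ ≤ w · #T`, if `w Σ |f - h| ≤ η`, `|h - Λ_b| ≤ Λ_b ε₃`, `|ρ - c| ≤ ε₁` and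
`ρ = κ f` termwise, then `X (1 - ε₃) - X η/(α₀ Λ_b) ≤ c + ε₁` and
`c - ε₁ ≤ X (1 + ε₃) + X η/(α₀ Λ_b)`. [folklore] -/
theorem kappa_bounds {ι : Type*} (T : Finset ι) (f h ρ : ι → ℝ) {w α₀ η Λb ε₁ ε₃ κ c : ℝ}
    (hw : 0 < w) (hα₀ : 0 < α₀) (hT : α₀ ≤ w * T.card) (hΛb : 0 < Λb) (hκ : 0 < κ)
    (hL1 : w * ∑ e ∈ T, |f e - h e| ≤ η)
    (hh : ∀ e ∈ T, |h e - Λb| ≤ Λb * ε₃) (hρ : ∀ e ∈ T, |ρ e - c| ≤ ε₁)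
    (hρf : ∀ e ∈ T, ρ e = κ * f e) :
    κ * Λb * (1 - ε₃) - κ * Λb * (η / (α₀ * Λb)) ≤ c + ε₁ ∧
      c - ε₁ ≤ κ * Λb * (1 + ε₃) + κ * Λb * (η / (α₀ * Λb)) := by
  set A : ℝ := w * T.card with hA
  have hA0 : 0 < A := hα₀.trans_le hT
  have hη0 : 0 ≤ η := le_trans (by positivity) hL1
  -- the three sums
  have hSf_Sh : |w * ∑ e ∈ T, f e - w * ∑ e ∈ T, h e| ≤ η := by
    rw [← mul_sub, ← Finset.sum_sub_distrib, abs_mul, abs_of_pos hw]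
    exact le_trans (mul_le_mul_of_nonneg_left (Finset.abs_sum_le_sum_abs _ _) hw.le) hL1
  have hSh_lo : A * (Λb * (1 - ε₃)) ≤ w * ∑ e ∈ T, h e := by
    rw [hA, mul_assoc, ← nsmul_eq_mul, ← Finset.sum_const]
    exact mul_le_mul_of_nonneg_left (Finset.sum_le_sum fun e he => by
      have := (abs_le.1 (hh e he)).1; linarith) hw.le
  have hSh_hi : w * ∑ e ∈ T, h e ≤ A * (Λb * (1 + ε₃)) := by
    rw [hA, mul_assoc, ← nsmul_eq_mul, ← Finset.sum_const]
    exact mul_le_mul_of_nonneg_left (Finset.sum_le_sum fun e he => by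
      have := (abs_le.1 (hh e he)).2; linarith) hw.le
  have hSρ_lo : A * (c - ε₁) ≤ w * ∑ e ∈ T, ρ e := by
    rw [hA, mul_assoc, ← nsmul_eq_mul, ← Finset.sum_const]
    exact mul_le_mul_of_nonneg_left (Finset.sum_le_sum fun e he => by
      have := (abs_le.1 (hρ e he)).1; linarith) hw.le
  have hSρ_hi : w * ∑ e ∈ T, ρ e ≤ A * (c + ε₁) := by
    rw [hA, mul_assoc, ← nsmul_eq_mul, ← Finset.sum_const]
    exact mul_le_mul_of_nonneg_left (Finset.sum_le_sum fun e he => by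
      have := (abs_le.1 (hρ e he)).2; linarith) hw.le
  have hSρ_eq : w * ∑ e ∈ T, ρ e = κ * (w * ∑ e ∈ T, f e) := by
    rw [Finset.sum_congr rfl fun e he => hρf e he, ← Finset.mul_sum]; ring
  set Sf := w * ∑ e ∈ T, f e with hSf
  set Sh := w * ∑ e ∈ T, h e with hSh
  have h1 := (abs_le.1 hSf_Sh).1
  have h2 := (abs_le.1 hSf_Sh).2
  -- divide by `A`
  have hX : κ * Λb * (η / (α₀ * Λb)) = κ * η / α₀ := by field_simp
  have hdiv : κ * η / A ≤ κ * η / α₀ :=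
    div_le_div_of_nonneg_left (by positivity) hα₀ hT
  constructor
  · -- κ (A Λb (1-ε₃) - η) ≤ κ Sf = Sρ ≤ A (c + ε₁)
    have step : κ * (A * (Λb * (1 - ε₃)) - η) ≤ A * (c + ε₁) := by
      calc κ * (A * (Λb * (1 - ε₃)) - η) ≤ κ * Sf := by
            apply mul_le_mul_of_nonneg_left _ hκ.le; linarith
        _ ≤ A * (c + ε₁) := by rw [← hSρ_eq]; exact hSρ_hi
    have step' : κ * Λb * (1 - ε₃) - κ * η / A ≤ c + ε₁ := by
      rw [sub_le_iff_le_add]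
      have : κ * (A * (Λb * (1 - ε₃)) - η) / A ≤ (A * (c + ε₁)) / A :=
        div_le_div_of_nonneg_right step hA0.le
      rw [mul_div_cancel_left₀ _ hA0.ne'] at this
      have e : κ * (A * (Λb * (1 - ε₃)) - η) / A = κ * Λb * (1 - ε₃) - κ * η / A := by
        field_simp
      linarith [this, e.symm.le, e.le]
    rw [hX]; linarith
  · have step : A * (c - ε₁) ≤ κ * (A * (Λb * (1 + ε₃)) + η) := by
      calc A * (c - ε₁) ≤ κ * Sf := by rw [← hSρ_eq]; exact hSρ_lo
        _ ≤ κ * (A * (Λb * (1 + ε₃)) + η) := by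
            apply mul_le_mul_of_nonneg_left _ hκ.le; linarith
    have step' : c - ε₁ ≤ κ * Λb * (1 + ε₃) + κ * η / A := by
      have : A * (c - ε₁) / A ≤ κ * (A * (Λb * (1 + ε₃)) + η) / A :=
        div_le_div_of_nonneg_right step hA0.le
      rw [mul_div_cancel_left₀ _ hA0.ne'] at this
      have e : κ * (A * (Λb * (1 + ε₃)) + η) / A = κ * Λb * (1 + ε₃) + κ * η / A := by
        field_simp
      linarith [this, e.symm.le, e.le]
    rw [hX]; linarith

/-- **From the two inequalities to `|X - c| ≤ 2 ε₁ + 2 c θ`** (`θ = ε₃ + η/(α₀ Λ_b) ≤ 1/2`).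
[folklore] -/
theorem abs_sub_le_of_kappa_bounds {X c ε₁ θ : ℝ} (hc : 0 ≤ c) (hε₁ : 0 ≤ ε₁)
    (hθ0 : 0 ≤ θ) (hθ : θ ≤ 1 / 2)
    (h1 : X * (1 - θ) ≤ c + ε₁) (h2 : c - ε₁ ≤ X * (1 + θ)) :
    |X - c| ≤ 2 * ε₁ + 2 * c * θ := by
  rw [abs_le]
  constructor
  · nlinarith
  · nlinarith

/-! ### Lemmas for the final summation -/

/-- `‖exp(i (5/8) θ)‖ = 1` for real `θ`. -/
theorem norm_exp_I_mul (θ : ℝ) : ‖Complex.exp (Complex.I * (5 / 8 : ℂ) * (θ : ℂ))‖ = 1 := by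
  rw [show Complex.I * (5 / 8 : ℂ) * (θ : ℂ) = ((5 / 8 * θ : ℝ) : ℂ) * Complex.I by push_cast; ring]
  exact Complex.norm_exp_ofReal_mul_I _

/-- `‖exp((5/8) w)‖ = exp((5/8) Re w)`. -/
theorem norm_exp_mul (w : ℂ) : ‖Complex.exp ((5 / 8 : ℂ) * w)‖ = Real.exp (5 / 8 * w.re) := by
  rw [Complex.norm_exp, show (5 / 8 : ℂ) = ((5 / 8 : ℝ) : ℂ) by norm_num, Complex.re_ofReal_mul]

/-- **Pointwise bound** behind the final summation: with `‖x‖ = κ f`, `‖y‖ Λ_b = H`, `‖y‖ ≤ M_H`,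
the phase error `≤ ε_p` and `|κ Λ_b - c_B| ≤ τ`,
`ψn ‖x - c_B u y‖ ≤ Mψ κ (ε_p + 1) |f - H| + Mψ M_H (ε_p κ Λ_b + τ)`. -/
theorem pointwise_bound {x y u : ℂ} {ψn Mψ cB κ f H Λb MH εp τ : ℝ}
    (hu : ‖u‖ = 1) (hy : y ≠ 0) (hψ : ψn ≤ Mψ) (hψ0 : 0 ≤ ψn) (hκ : 0 ≤ κ)
    (hx : ‖x‖ = κ * f) (hyH : ‖y‖ * Λb = H) (hΛb : 0 < Λb) (hyM : ‖y‖ ≤ MH) (hεp : 0 ≤ εp)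
    (hph : ‖x / ((‖x‖ : ℝ) : ℂ) - u * (y / ((‖y‖ : ℝ) : ℂ))‖ ≤ εp) (hX : |κ * Λb - cB| ≤ τ) :
    ψn * ‖x - (cB : ℂ) * u * y‖ ≤
      Mψ * κ * (εp + 1) * |f - H| + Mψ * MH * (εp * κ * Λb + τ) := by
  have h0 := norm_sub_smul_le x y u cB hu hy
  have hyn : 0 ≤ ‖y‖ := norm_nonneg _
  have hτ0 : 0 ≤ τ := (abs_nonneg _).trans hX
  have hf0 : 0 ≤ κ * f := by rw [← hx]; exact norm_nonneg _
  have hMHnn : 0 ≤ MH := hyn.trans hyM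
  -- the modulus part
  have h1 : |‖x‖ - cB * ‖y‖| ≤ κ * |f - H| + MH * τ := by
    have e : ‖x‖ - cB * ‖y‖ = κ * (f - H) + ‖y‖ * (κ * Λb - cB) := by
      rw [hx, ← hyH]; ring
    rw [e]
    calc |κ * (f - H) + ‖y‖ * (κ * Λb - cB)| ≤ |κ * (f - H)| + |‖y‖ * (κ * Λb - cB)| := abs_add_le _ _
      _ = κ * |f - H| + ‖y‖ * |κ * Λb - cB| := by
          rw [abs_mul, abs_mul, abs_of_nonneg hκ, abs_of_nonneg hyn]
      _ ≤ κ * |f - H| + MH * τ := by gcongr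
  -- the argument part
  have h2 : ‖x‖ * ‖x / ((‖x‖ : ℝ) : ℂ) - u * (y / ((‖y‖ : ℝ) : ℂ))‖ ≤
      εp * κ * |f - H| + εp * κ * Λb * MH := by
    have hfle : κ * f ≤ κ * |f - H| + κ * Λb * ‖y‖ := by
      have h' : f ≤ |f - H| + H := by linarith [le_abs_self (f - H)]
      calc κ * f ≤ κ * (|f - H| + H) := mul_le_mul_of_nonneg_left h' hκ
        _ = κ * |f - H| + κ * Λb * ‖y‖ := by rw [← hyH]; ring
    calc ‖x‖ * ‖x / ((‖x‖ : ℝ) : ℂ) - u * (y / ((‖y‖ : ℝ) : ℂ))‖ ≤ (κ * f) * εp :=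
          mul_le_mul hx.le hph (norm_nonneg _) hf0
      _ ≤ (κ * |f - H| + κ * Λb * ‖y‖) * εp := mul_le_mul_of_nonneg_right hfle hεp
      _ ≤ (κ * |f - H| + κ * Λb * MH) * εp := by gcongr
      _ = εp * κ * |f - H| + εp * κ * Λb * MH := by ring
  have h3 : ‖x - (cB : ℂ) * u * y‖ ≤ κ * (εp + 1) * |f - H| + MH * (εp * κ * Λb + τ) := by
    linarith
  have hR : 0 ≤ κ * (εp + 1) * |f - H| + MH * (εp * κ * Λb + τ) := le_trans (norm_nonneg _) h3
  calc ψn * ‖x - (cB : ℂ) * u * y‖ ≤ Mψ * (κ * (εp + 1) * |f - H| + MH * (εp * κ * Λb + τ)) :=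
        mul_le_mul hψ h3 (norm_nonneg _) (hψ0.trans hψ)
    _ = _ := by ring

end Summit.CriticalPhenomena.SAWScalingLimit.Theorems.RetrievalSynthesisR
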